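/-
  HodgeLocusCensusUnitColumnRankDropBand.lean — pub-hlocus ENGINE B (ivhs-2, gen 56), PROBE 19b.
  certified instances and evidence bearing on the general Hodge conjecture; no claim.

  KERNEL RANK THEOREMS (evidence class; no census number changes; nothing about HC). THE FIRST BAND OF EXCEPTIONS AND THE SECOND BOUNDARY.
  For a prime p > c ≥ 1, a field K of characteristic p, a field K₀ of characteristic 0 and anchor 229's multiplicity matrix of ×q^c on
  K[x₁,…,x_k]/(xᵢ^{e+2}) at level j (VERBATIM, as in anchors 230/294/296/298/304), in the notation of anchor 304's (DROP) (= PROBE 19; feasible labels μ: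
  e+1 ∣ j + Σμ, (e+1)s ≤ j + Σμ; s = #{μ ≠ 0}, t = (j + Σμ)/(e+1) − s, m = k − s; non-empty block t + c ≤ m; T = min (t, m − t − c)):
  (BAND) `rank_charP_add_sum_single_eq_rank_charZero` — for k < 2p + c (the first band 2p − c ≤ k < 2p + c of exceptions at p; below it there is
      none, anchor 296) NO characteristic-0 correction survives (`corr_zero_eq_zero_of_lt`: T < p) and each label carries AT MOST ONE binomial
      (`corr_prime_eq_single_of_lt`: T + c < 2p), so  rank_K + Σ_{μ : T + c ≥ p} C(m, T + c − p) = rank_{K₀}.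
  (BDRY2) `rank_charP_add_eq_rank_charZero_second_boundary` — HEADLINE: for k + c = 2p + 1,
      rank_K + [j = (e+1)(p − c) ∨ j = (e+1)(p − c + 1)] + k·[(e+1)(p − c) < j < (e+1)(p − c + 1)] = rank_{K₀},
      i.e. across the band of e + 2 levels (e+1)(p − c) ≤ j ≤ (e+1)(p − c + 1) the characteristic-p rank drops by 1, k, …, k, 1 and nowhere else
      (the zero label gives the two ends, `single_zero_label`; the k one-coordinate labels a·δ_l with j + a = (e+1)(p − c + 1) give the interior,
      `single_eq_ite_of_card_eq_one` + the count `card_filter_card_eq_one_and_sum_eq`: #{μ : one non-zero coordinate, Σμ = a} = k for 1 ≤ a ≤ e;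
      labels with two non-zero coordinates give nothing, `single_eq_zero_of_two_le`). Anchor 304's (BDRY) is the first boundary k + c = 2p.
  10 theorems, 0 defs; imports anchor 304 `…HodgeLocusCensusUnitColumnRankDrop` by name (hence 296, 294, 293, 230, 229); nothing restated but
  anchor 229's matrix and anchor 294's feasibility / block conditions (VERBATIM); no sorries, axioms, instances or notation.
-/
import Summits.HodgeConjecture.HodgeConjecture.Theorems.HodgeLocusCensusUnitColumnRankDrop

set_option linter.dupNamespace false
set_option autoImplicit false

namespace Summit.HodgeConjecture.HodgeConjecture.HodgeLocus.Census.UnitColumnRankDropBand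

open Summit.HodgeConjecture.HodgeConjecture.HodgeLocus.Census.ModelNonJumpC1All (colR)
open Summit.HodgeConjecture.HodgeConjecture.HodgeLocus.Census.UnitColumnRankDrop (rank_charP_add_eq_rank_charZero_add)

/-! ## §1 THE FIRST BAND `k < 2p + c`: no characteristic-`0` correction, at most one binomial per label -/

/-- (A1) for `k < 2p + c` NO characteristic-`0` correction term survives: every non-empty feasible block has `T < p` (`2T + c ≤ m ≤ k`). -/
theorem corr_zero_eq_zero_of_lt (p k e c j : ℕ) (hk : k < 2 * p + c) (μ : Fin k → Fin (e + 1)) :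
    (if (e + 1) ∣ (j + ∑ i, (μ i : ℕ)) ∧ (e + 1) * (Finset.univ.filter (fun l => (μ l : ℕ) ≠ 0)).card ≤ j + ∑ i, (μ i : ℕ) then
      (if k - (Finset.univ.filter (fun l => (μ l : ℕ) ≠ 0)).card < ((j + ∑ i, (μ i : ℕ)) / (e + 1) - (Finset.univ.filter (fun l => (μ l : ℕ) ≠ 0)).card) + c then 0
       else ∑ b ∈ Finset.range ((min ((j + ∑ i, (μ i : ℕ)) / (e + 1) - (Finset.univ.filter (fun l => (μ l : ℕ) ≠ 0)).card)
           (k - (Finset.univ.filter (fun l => (μ l : ℕ) ≠ 0)).card -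
             ((j + ∑ i, (μ i : ℕ)) / (e + 1) - (Finset.univ.filter (fun l => (μ l : ℕ) ≠ 0)).card) - c)) / p),
         (k - (Finset.univ.filter (fun l => (μ l : ℕ) ≠ 0)).card).choose (min ((j + ∑ i, (μ i : ℕ)) / (e + 1) - (Finset.univ.filter (fun l => (μ l : ℕ) ≠ 0)).card)
           (k - (Finset.univ.filter (fun l => (μ l : ℕ) ≠ 0)).card -
             ((j + ∑ i, (μ i : ℕ)) / (e + 1) - (Finset.univ.filter (fun l => (μ l : ℕ) ≠ 0)).card) - c) - (b + 1) * p))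
     else 0) = 0 := by
  have hs : (Finset.univ.filter (fun l => (μ l : ℕ) ≠ 0)).card ≤ k :=
    (Finset.card_filter_le _ _).trans_eq (by rw [Finset.card_univ, Fintype.card_fin])
  split_ifs with hF hlt
  · rfl
  · rw [Nat.div_eq_of_lt (by rw [Nat.min_def]; split_ifs <;> omega), Finset.range_zero, Finset.sum_empty]
  · rfl

/-- (A2) for `k < 2p + c` the characteristic-`p` correction term of a label has AT MOST ONE binomial: `T + c < 2p`, so it is `0` if `T + c < p` and
`C(m, T + c − p)` otherwise (`c < p`). -/
theorem corr_prime_eq_single_of_lt (p k e c j : ℕ) (hp : 0 < p) (hcp : c < p) (hk : k < 2 * p + c) (μ : Fin k → Fin (e + 1)) :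
    (if (e + 1) ∣ (j + ∑ i, (μ i : ℕ)) ∧ (e + 1) * (Finset.univ.filter (fun l => (μ l : ℕ) ≠ 0)).card ≤ j + ∑ i, (μ i : ℕ) then
      (if k - (Finset.univ.filter (fun l => (μ l : ℕ) ≠ 0)).card < ((j + ∑ i, (μ i : ℕ)) / (e + 1) - (Finset.univ.filter (fun l => (μ l : ℕ) ≠ 0)).card) + c then 0
       else ∑ b ∈ Finset.range ((min ((j + ∑ i, (μ i : ℕ)) / (e + 1) - (Finset.univ.filter (fun l => (μ l : ℕ) ≠ 0)).card)
           (k - (Finset.univ.filter (fun l => (μ l : ℕ) ≠ 0)).card -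
             ((j + ∑ i, (μ i : ℕ)) / (e + 1) - (Finset.univ.filter (fun l => (μ l : ℕ) ≠ 0)).card) - c) + c) / p),
         (k - (Finset.univ.filter (fun l => (μ l : ℕ) ≠ 0)).card).choose (min ((j + ∑ i, (μ i : ℕ)) / (e + 1) - (Finset.univ.filter (fun l => (μ l : ℕ) ≠ 0)).card)
           (k - (Finset.univ.filter (fun l => (μ l : ℕ) ≠ 0)).card -
             ((j + ∑ i, (μ i : ℕ)) / (e + 1) - (Finset.univ.filter (fun l => (μ l : ℕ) ≠ 0)).card) - c) + c - (b + 1) * p))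
     else 0) =
    (if (e + 1) ∣ (j + ∑ i, (μ i : ℕ)) ∧ (e + 1) * (Finset.univ.filter (fun l => (μ l : ℕ) ≠ 0)).card ≤ j + ∑ i, (μ i : ℕ) then
      (if k - (Finset.univ.filter (fun l => (μ l : ℕ) ≠ 0)).card < ((j + ∑ i, (μ i : ℕ)) / (e + 1) - (Finset.univ.filter (fun l => (μ l : ℕ) ≠ 0)).card) + c then 0
       else if min ((j + ∑ i, (μ i : ℕ)) / (e + 1) - (Finset.univ.filter (fun l => (μ l : ℕ) ≠ 0)).card)
           (k - (Finset.univ.filter (fun l => (μ l : ℕ) ≠ 0)).card -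
             ((j + ∑ i, (μ i : ℕ)) / (e + 1) - (Finset.univ.filter (fun l => (μ l : ℕ) ≠ 0)).card) - c) + c < p then 0
       else (k - (Finset.univ.filter (fun l => (μ l : ℕ) ≠ 0)).card).choose (min ((j + ∑ i, (μ i : ℕ)) / (e + 1) - (Finset.univ.filter (fun l => (μ l : ℕ) ≠ 0)).card)
           (k - (Finset.univ.filter (fun l => (μ l : ℕ) ≠ 0)).card -
             ((j + ∑ i, (μ i : ℕ)) / (e + 1) - (Finset.univ.filter (fun l => (μ l : ℕ) ≠ 0)).card) - c) + c - p))
     else 0) := by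
  have hs : (Finset.univ.filter (fun l => (μ l : ℕ) ≠ 0)).card ≤ k :=
    (Finset.card_filter_le _ _).trans_eq (by rw [Finset.card_univ, Fintype.card_fin])
  by_cases hF : (e + 1) ∣ (j + ∑ i, (μ i : ℕ)) ∧ (e + 1) * (Finset.univ.filter (fun l => (μ l : ℕ) ≠ 0)).card ≤ j + ∑ i, (μ i : ℕ)
  · rw [if_pos hF, if_pos hF]
    by_cases hlt : k - (Finset.univ.filter (fun l => (μ l : ℕ) ≠ 0)).card < ((j + ∑ i, (μ i : ℕ)) / (e + 1) - (Finset.univ.filter (fun l => (μ l : ℕ) ≠ 0)).card) + c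
    · rw [if_pos hlt, if_pos hlt]
    · rw [if_neg hlt, if_neg hlt]
      have hT : min ((j + ∑ i, (μ i : ℕ)) / (e + 1) - (Finset.univ.filter (fun l => (μ l : ℕ) ≠ 0)).card)
          (k - (Finset.univ.filter (fun l => (μ l : ℕ) ≠ 0)).card -
            ((j + ∑ i, (μ i : ℕ)) / (e + 1) - (Finset.univ.filter (fun l => (μ l : ℕ) ≠ 0)).card) - c) < p := by
        rw [Nat.min_def]; split_ifs <;> omega
      by_cases hb : min ((j + ∑ i, (μ i : ℕ)) / (e + 1) - (Finset.univ.filter (fun l => (μ l : ℕ) ≠ 0)).card)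
          (k - (Finset.univ.filter (fun l => (μ l : ℕ) ≠ 0)).card -
            ((j + ∑ i, (μ i : ℕ)) / (e + 1) - (Finset.univ.filter (fun l => (μ l : ℕ) ≠ 0)).card) - c) + c < p
      · rw [if_pos hb, Nat.div_eq_of_lt hb, Finset.range_zero, Finset.sum_empty]
      · have hd : ∀ x, p ≤ x → x < 2 * p → x / p = 1 := fun x h1 h2 => Nat.div_eq_of_lt_le (by omega) (by omega)
        rw [if_neg hb, hd _ (Nat.le_of_not_lt hb) (by omega), Finset.sum_range_one, zero_add, one_mul]
  · rw [if_neg hF, if_neg hF]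

/-- **(BAND) THE FIRST BAND `2p − c ≤ k < 2p + c` OF EXCEPTIONS AT `p`**: for a prime `p > c` and `k < 2p + c` (no exception at all when `k + c < 2p`,
anchor 296), anchor 229's multiplicity matrix of `×q^c` (VERBATIM) satisfies `rank_K + Σ_μ C(m, T + c − p) = rank_{K₀}`, the sum over the feasible
labels `μ` with a non-empty block and `T + c ≥ p` (notation of anchor 304's (DROP): `s = #{μ ≠ 0}`, `t = (j + Σμ)/(e+1) − s`, `m = k − s`,
`T = min (t, m − t − c)`): anchor 304's (DROP) with (A1), (A2). -/
theorem rank_charP_add_sum_single_eq_rank_charZero (K K₀ : Type*) [Field K] [Field K₀] (p : ℕ) [CharP K p] [CharZero K₀] (hp : p.Prime)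
    (k e c j : ℕ) (hcp : c < p) (hk : k < 2 * p + c) :
    (Matrix.of fun (v : {v : Fin k → Fin (e + 2) // (∑ i, (v i : ℕ)) + j = k * (e + 1)})
        (m : {m : Fin k → Fin (e + 2) // (∑ i, (m i : ℕ)) + (j + c * (e + 1)) = k * (e + 1)}) =>
      ((((List.flatMap (colR (e + 3)))^[c] [List.ofFn (fun i => (m.1 i : ℕ))]).count (List.ofFn (fun i => (v.1 i : ℕ))) : ℕ) : K)).rank +
      ∑ μ : Fin k → Fin (e + 1),
        (if (e + 1) ∣ (j + ∑ i, (μ i : ℕ)) ∧ (e + 1) * (Finset.univ.filter (fun l => (μ l : ℕ) ≠ 0)).card ≤ j + ∑ i, (μ i : ℕ) then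
          (if k - (Finset.univ.filter (fun l => (μ l : ℕ) ≠ 0)).card < ((j + ∑ i, (μ i : ℕ)) / (e + 1) - (Finset.univ.filter (fun l => (μ l : ℕ) ≠ 0)).card) + c then 0
           else if min ((j + ∑ i, (μ i : ℕ)) / (e + 1) - (Finset.univ.filter (fun l => (μ l : ℕ) ≠ 0)).card)
               (k - (Finset.univ.filter (fun l => (μ l : ℕ) ≠ 0)).card -
                 ((j + ∑ i, (μ i : ℕ)) / (e + 1) - (Finset.univ.filter (fun l => (μ l : ℕ) ≠ 0)).card) - c) + c < p then 0
           else (k - (Finset.univ.filter (fun l => (μ l : ℕ) ≠ 0)).card).choose (min ((j + ∑ i, (μ i : ℕ)) / (e + 1) - (Finset.univ.filter (fun l => (μ l : ℕ) ≠ 0)).card)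
               (k - (Finset.univ.filter (fun l => (μ l : ℕ) ≠ 0)).card -
                 ((j + ∑ i, (μ i : ℕ)) / (e + 1) - (Finset.univ.filter (fun l => (μ l : ℕ) ≠ 0)).card) - c) + c - p))
         else 0) =
    (Matrix.of fun (v : {v : Fin k → Fin (e + 2) // (∑ i, (v i : ℕ)) + j = k * (e + 1)})
        (m : {m : Fin k → Fin (e + 2) // (∑ i, (m i : ℕ)) + (j + c * (e + 1)) = k * (e + 1)}) =>
      ((((List.flatMap (colR (e + 3)))^[c] [List.ofFn (fun i => (m.1 i : ℕ))]).count (List.ofFn (fun i => (v.1 i : ℕ))) : ℕ) : K₀)).rank := by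
  have h := rank_charP_add_eq_rank_charZero_add K K₀ p hp k e c j hcp
  rw [Finset.sum_eq_zero (fun μ _ => corr_zero_eq_zero_of_lt p k e c j hk μ), add_zero,
    Finset.sum_congr rfl (fun μ _ => corr_prime_eq_single_of_lt p k e c j hp.pos hcp hk μ)] at h
  exact h

/-! ## §2 THE SECOND BOUNDARY `k + c = 2p + 1`: drops `1, k, …, k, 1` across the band `(e+1)(p − c) ≤ j ≤ (e+1)(p − c + 1)` -/

/-- (S2) for `k + c ≤ 2p + 1` a label with at least TWO non-zero coordinates (`m ≤ k − 2`) carries no correction: `T + c < p`. -/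
theorem single_eq_zero_of_two_le (p k e c j : ℕ) (hk : k + c ≤ 2 * p + 1) (μ : Fin k → Fin (e + 1))
    (h2 : 2 ≤ (Finset.univ.filter (fun l => (μ l : ℕ) ≠ 0)).card) :
    (if (e + 1) ∣ (j + ∑ i, (μ i : ℕ)) ∧ (e + 1) * (Finset.univ.filter (fun l => (μ l : ℕ) ≠ 0)).card ≤ j + ∑ i, (μ i : ℕ) then
      (if k - (Finset.univ.filter (fun l => (μ l : ℕ) ≠ 0)).card < ((j + ∑ i, (μ i : ℕ)) / (e + 1) - (Finset.univ.filter (fun l => (μ l : ℕ) ≠ 0)).card) + c then 0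
       else if min ((j + ∑ i, (μ i : ℕ)) / (e + 1) - (Finset.univ.filter (fun l => (μ l : ℕ) ≠ 0)).card)
           (k - (Finset.univ.filter (fun l => (μ l : ℕ) ≠ 0)).card -
             ((j + ∑ i, (μ i : ℕ)) / (e + 1) - (Finset.univ.filter (fun l => (μ l : ℕ) ≠ 0)).card) - c) + c < p then 0
       else (k - (Finset.univ.filter (fun l => (μ l : ℕ) ≠ 0)).card).choose (min ((j + ∑ i, (μ i : ℕ)) / (e + 1) - (Finset.univ.filter (fun l => (μ l : ℕ) ≠ 0)).card)
           (k - (Finset.univ.filter (fun l => (μ l : ℕ) ≠ 0)).card -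
             ((j + ∑ i, (μ i : ℕ)) / (e + 1) - (Finset.univ.filter (fun l => (μ l : ℕ) ≠ 0)).card) - c) + c - p))
     else 0) = 0 := by
  have hs : (Finset.univ.filter (fun l => (μ l : ℕ) ≠ 0)).card ≤ k :=
    (Finset.card_filter_le _ _).trans_eq (by rw [Finset.card_univ, Fintype.card_fin])
  split_ifs with hF hlt hb
  · rfl
  · rfl
  · exfalso
    revert hb
    rw [imp_false, not_not, Nat.min_def]
    split_ifs <;> omega
  · rfl

/-- (S1) for `c < p` and `k + c = 2p + 1` a label with EXACTLY ONE non-zero coordinate (`m = k − 1 = 2p − c`) carries the correction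
`[j + Σμ = (e+1)(p − c + 1)]` (its block has `T + c ≥ p` iff `t = p − c = m − t − c`, and then the binomial is `C(m, 0) = 1`). -/
theorem single_eq_ite_of_card_eq_one (p k e c j : ℕ) (hcp : c < p) (hk : k + c = 2 * p + 1) (μ : Fin k → Fin (e + 1))
    (h1 : (Finset.univ.filter (fun l => (μ l : ℕ) ≠ 0)).card = 1) :
    (if (e + 1) ∣ (j + ∑ i, (μ i : ℕ)) ∧ (e + 1) * (Finset.univ.filter (fun l => (μ l : ℕ) ≠ 0)).card ≤ j + ∑ i, (μ i : ℕ) then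
      (if k - (Finset.univ.filter (fun l => (μ l : ℕ) ≠ 0)).card < ((j + ∑ i, (μ i : ℕ)) / (e + 1) - (Finset.univ.filter (fun l => (μ l : ℕ) ≠ 0)).card) + c then 0
       else if min ((j + ∑ i, (μ i : ℕ)) / (e + 1) - (Finset.univ.filter (fun l => (μ l : ℕ) ≠ 0)).card)
           (k - (Finset.univ.filter (fun l => (μ l : ℕ) ≠ 0)).card -
             ((j + ∑ i, (μ i : ℕ)) / (e + 1) - (Finset.univ.filter (fun l => (μ l : ℕ) ≠ 0)).card) - c) + c < p then 0
       else (k - (Finset.univ.filter (fun l => (μ l : ℕ) ≠ 0)).card).choose (min ((j + ∑ i, (μ i : ℕ)) / (e + 1) - (Finset.univ.filter (fun l => (μ l : ℕ) ≠ 0)).card)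
           (k - (Finset.univ.filter (fun l => (μ l : ℕ) ≠ 0)).card -
             ((j + ∑ i, (μ i : ℕ)) / (e + 1) - (Finset.univ.filter (fun l => (μ l : ℕ) ≠ 0)).card) - c) + c - p))
     else 0) =
    if j + ∑ i, (μ i : ℕ) = (e + 1) * (p - c + 1) then 1 else 0 := by
  rw [h1]
  by_cases hN : j + ∑ i, (μ i : ℕ) = (e + 1) * (p - c + 1)
  · rw [if_pos hN, hN, if_pos ⟨Dvd.intro _ rfl, Nat.mul_le_mul_left (e + 1) (show 1 ≤ p - c + 1 by omega)⟩, Nat.mul_div_cancel_left _ (Nat.succ_pos e),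
      if_neg (by omega), show k - 1 - (p - c + 1 - 1) - c = p - c + 1 - 1 by omega, Nat.min_self, if_neg (by omega),
      show p - c + 1 - 1 + c - p = 0 by omega, Nat.choose_zero_right]
  · rw [if_neg hN]
    split_ifs with hF hlt hb
    · rfl
    · rfl
    · exfalso
      obtain ⟨⟨q, hq⟩, -⟩ := hF
      rw [hq] at hN hlt hb
      rw [Nat.mul_div_cancel_left q (Nat.succ_pos e)] at hlt hb
      have hq' : q ≠ p - c + 1 := fun h => hN (by rw [h])
      revert hb
      rw [imp_false, not_not, Nat.min_def]
      split_ifs <;> omega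
    · rfl

/-- (S0) for `c < p` and `k + c = 2p + 1` the ZERO label (`m = k = 2p + 1 − c`) carries the correction `[j = (e+1)(p − c) ∨ j = (e+1)(p − c + 1)]`
(`T + c ≥ p` iff `t ∈ {p − c, p − c + 1}`, and then `T = p − c`, binomial `C(k, 0) = 1`). -/
theorem single_zero_label (p k e c j : ℕ) (hcp : c < p) (hk : k + c = 2 * p + 1) :
    (fun (μ : Fin k → Fin (e + 1)) =>
      (if (e + 1) ∣ (j + ∑ i, (μ i : ℕ)) ∧ (e + 1) * (Finset.univ.filter (fun l => (μ l : ℕ) ≠ 0)).card ≤ j + ∑ i, (μ i : ℕ) then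
        (if k - (Finset.univ.filter (fun l => (μ l : ℕ) ≠ 0)).card < ((j + ∑ i, (μ i : ℕ)) / (e + 1) - (Finset.univ.filter (fun l => (μ l : ℕ) ≠ 0)).card) + c then 0
         else if min ((j + ∑ i, (μ i : ℕ)) / (e + 1) - (Finset.univ.filter (fun l => (μ l : ℕ) ≠ 0)).card)
             (k - (Finset.univ.filter (fun l => (μ l : ℕ) ≠ 0)).card -
               ((j + ∑ i, (μ i : ℕ)) / (e + 1) - (Finset.univ.filter (fun l => (μ l : ℕ) ≠ 0)).card) - c) + c < p then 0
         else (k - (Finset.univ.filter (fun l => (μ l : ℕ) ≠ 0)).card).choose (min ((j + ∑ i, (μ i : ℕ)) / (e + 1) - (Finset.univ.filter (fun l => (μ l : ℕ) ≠ 0)).card)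
             (k - (Finset.univ.filter (fun l => (μ l : ℕ) ≠ 0)).card -
               ((j + ∑ i, (μ i : ℕ)) / (e + 1) - (Finset.univ.filter (fun l => (μ l : ℕ) ≠ 0)).card) - c) + c - p))
       else 0)) (fun _ => 0) =
    if j = (e + 1) * (p - c) ∨ j = (e + 1) * (p - c + 1) then 1 else 0 := by
  have hs : (Finset.univ.filter (fun l : Fin k => (((fun _ => (0 : Fin (e + 1))) l : Fin (e + 1)) : ℕ) ≠ 0)).card = 0 := by
    simp
  have hsum : (∑ i : Fin k, (((fun _ => (0 : Fin (e + 1))) i : Fin (e + 1)) : ℕ)) = 0 := by simp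
  simp only [hs, hsum, add_zero, mul_zero, Nat.sub_zero]
  by_cases hd : (e + 1) ∣ j
  · obtain ⟨t, rfl⟩ := hd
    rw [if_pos ⟨Dvd.intro _ rfl, Nat.zero_le _⟩, Nat.mul_div_cancel_left t (Nat.succ_pos e)]
    by_cases ht : t = p - c ∨ t = p - c + 1
    · have hT : min t (k - t - c) = p - c := by rw [Nat.min_def]; split_ifs <;> omega
      rw [if_neg (by omega), hT, if_neg (by omega), Nat.sub_add_cancel hcp.le, Nat.sub_self, Nat.choose_zero_right, if_pos]
      rcases ht with rfl | rfl
      · exact Or.inl rfl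
      · exact Or.inr rfl
    · rw [if_neg (show ¬ ((e + 1) * t = (e + 1) * (p - c) ∨ (e + 1) * t = (e + 1) * (p - c + 1)) from fun h =>
        ht (h.imp (fun h => Nat.eq_of_mul_eq_mul_left (Nat.succ_pos e) h) (fun h => Nat.eq_of_mul_eq_mul_left (Nat.succ_pos e) h)))]
      split_ifs with hlt hb
      · rfl
      · rfl
      · exfalso
        revert hb
        rw [imp_false, not_not, Nat.min_def]
        split_ifs <;> omega
  · rw [if_neg (fun h => hd h.1), if_neg]
    rintro (h | h)
    · exact hd (by rw [h]; exact Dvd.intro _ rfl)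
    · exact hd (by rw [h]; exact Dvd.intro _ rfl)

/-- (C1) COUNTING THE ONE-COORDINATE LABELS: for `1 ≤ a ≤ e` exactly `k` labels `μ : Fin k → Fin (e+1)` have one non-zero coordinate and `Σμ = a`
(`μ = a·δ_l`, `l < k`); for `a = 0` or `a > e` there is none. -/
theorem card_filter_card_eq_one_and_sum_eq (k e a : ℕ) :
    (Finset.univ.filter (fun μ : Fin k → Fin (e + 1) =>
        (Finset.univ.filter (fun l => (μ l : ℕ) ≠ 0)).card = 1 ∧ (∑ i, (μ i : ℕ)) = a)).card =
      if 1 ≤ a ∧ a ≤ e then k else 0 := by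
  by_cases ha : 1 ≤ a ∧ a ≤ e
  · rw [if_pos ha]
    have hae : a < e + 1 := by omega
    have himg : Finset.univ.filter (fun μ : Fin k → Fin (e + 1) =>
        (Finset.univ.filter (fun l => (μ l : ℕ) ≠ 0)).card = 1 ∧ (∑ i, (μ i : ℕ)) = a) =
        Finset.univ.image (fun l : Fin k => Pi.single l (⟨a, hae⟩ : Fin (e + 1))) := by
      ext μ
      simp only [Finset.mem_filter, Finset.mem_univ, true_and, Finset.mem_image]
      constructor
      · rintro ⟨h1, h2⟩
        obtain ⟨l, hl⟩ := Finset.card_eq_one.mp h1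
        have hμ : ∀ i, i ≠ l → μ i = 0 := by
          intro i hi
          by_contra h
          have : i ∈ (Finset.univ.filter (fun l => (μ l : ℕ) ≠ 0)) :=
            Finset.mem_filter.mpr ⟨Finset.mem_univ _, fun h' => h (Fin.ext h')⟩
          rw [hl, Finset.mem_singleton] at this
          exact hi this
        have hsum : (∑ i, (μ i : ℕ)) = (μ l : ℕ) := by
          rw [Finset.sum_eq_single l (fun i _ hi => by rw [hμ i hi]; rfl) (fun h => absurd (Finset.mem_univ l) h)]
        refine ⟨l, ?_⟩
        funext i
        by_cases hi : i = l
        · subst hi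
          rw [Pi.single_eq_same]
          exact Fin.ext (show a = ((μ _ : Fin (e + 1)) : ℕ) by omega)
        · rw [Pi.single_eq_of_ne hi, hμ i hi]
      · rintro ⟨l, rfl⟩
        have hfl : (Finset.univ.filter (fun i => ((Pi.single l (⟨a, hae⟩ : Fin (e + 1)) : Fin k → Fin (e + 1)) i : ℕ) ≠ 0)) = {l} := by
          ext i
          simp only [Finset.mem_filter, Finset.mem_univ, true_and, Finset.mem_singleton]
          by_cases hi : i = l
          · subst hi
            rw [Pi.single_eq_same]
            exact iff_of_true (by simp only [ne_eq]; omega) rfl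
          · rw [Pi.single_eq_of_ne hi]
            exact iff_of_false (fun h => h rfl) hi
        refine ⟨by rw [hfl, Finset.card_singleton], ?_⟩
        rw [Finset.sum_eq_single l (fun i _ hi => by rw [Pi.single_eq_of_ne hi]; rfl) (fun h => absurd (Finset.mem_univ l) h),
          Pi.single_eq_same]
    rw [himg, Finset.card_image_of_injective _ (fun l₁ l₂ h => ?_), Finset.card_univ, Fintype.card_fin]
    by_contra hne
    have h1 := congr_fun h l₁
    rw [Pi.single_eq_same, Pi.single_eq_of_ne hne] at h1
    exact absurd (congr_arg Fin.val h1) (by simp only [Fin.val_zero]; omega)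
  · rw [if_neg ha, Finset.card_eq_zero, Finset.filter_eq_empty_iff]
    rintro μ - ⟨h1, h2⟩
    obtain ⟨l, hl⟩ := Finset.card_eq_one.mp h1
    have hμ : ∀ i, i ≠ l → μ i = 0 := by
      intro i hi
      by_contra h
      have : i ∈ (Finset.univ.filter (fun l => (μ l : ℕ) ≠ 0)) :=
        Finset.mem_filter.mpr ⟨Finset.mem_univ _, fun h' => h (Fin.ext h')⟩
      rw [hl, Finset.mem_singleton] at this
      exact hi this
    have hl1 : l ∈ Finset.univ.filter (fun l => (μ l : ℕ) ≠ 0) := by rw [hl]; exact Finset.mem_singleton_self l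
    have hl0 : (μ l : ℕ) ≠ 0 := (Finset.mem_filter.mp hl1).2
    have hsum : (∑ i, (μ i : ℕ)) = (μ l : ℕ) := by
      rw [Finset.sum_eq_single l (fun i _ hi => by rw [hμ i hi]; rfl) (fun h => absurd (Finset.mem_univ l) h)]
    have hlt : (μ l : ℕ) < e + 1 := (μ l).2
    omega

/-- (C2) the one-coordinate labels contribute `k · [(e+1)(p − c) < j < (e+1)(p − c + 1)]` in total (`c < p`, `k + c = 2p + 1`; (S1), (C1) with
`a = (e+1)(p − c + 1) − j`). -/
theorem sum_filter_card_eq_one_single (p k e c j : ℕ) (hcp : c < p) (hk : k + c = 2 * p + 1) :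
    (∑ μ ∈ Finset.univ.filter (fun μ : Fin k → Fin (e + 1) => (Finset.univ.filter (fun l => (μ l : ℕ) ≠ 0)).card = 1),
      (if (e + 1) ∣ (j + ∑ i, (μ i : ℕ)) ∧ (e + 1) * (Finset.univ.filter (fun l => (μ l : ℕ) ≠ 0)).card ≤ j + ∑ i, (μ i : ℕ) then
        (if k - (Finset.univ.filter (fun l => (μ l : ℕ) ≠ 0)).card < ((j + ∑ i, (μ i : ℕ)) / (e + 1) - (Finset.univ.filter (fun l => (μ l : ℕ) ≠ 0)).card) + c then 0
         else if min ((j + ∑ i, (μ i : ℕ)) / (e + 1) - (Finset.univ.filter (fun l => (μ l : ℕ) ≠ 0)).card)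
             (k - (Finset.univ.filter (fun l => (μ l : ℕ) ≠ 0)).card -
               ((j + ∑ i, (μ i : ℕ)) / (e + 1) - (Finset.univ.filter (fun l => (μ l : ℕ) ≠ 0)).card) - c) + c < p then 0
         else (k - (Finset.univ.filter (fun l => (μ l : ℕ) ≠ 0)).card).choose (min ((j + ∑ i, (μ i : ℕ)) / (e + 1) - (Finset.univ.filter (fun l => (μ l : ℕ) ≠ 0)).card)
             (k - (Finset.univ.filter (fun l => (μ l : ℕ) ≠ 0)).card -
               ((j + ∑ i, (μ i : ℕ)) / (e + 1) - (Finset.univ.filter (fun l => (μ l : ℕ) ≠ 0)).card) - c) + c - p))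
       else 0)) =
    if (e + 1) * (p - c) < j ∧ j < (e + 1) * (p - c + 1) then k else 0 := by
  rw [Finset.sum_congr rfl (fun μ hμ => single_eq_ite_of_card_eq_one p k e c j hcp hk μ (Finset.mem_filter.mp hμ).2),
    ← Finset.sum_filter, Finset.filter_filter, Finset.sum_const, smul_eq_mul, mul_one]
  by_cases hj : j ≤ (e + 1) * (p - c + 1)
  · have h := card_filter_card_eq_one_and_sum_eq k e ((e + 1) * (p - c + 1) - j)
    rw [Finset.filter_congr (fun μ _ => show (Finset.univ.filter (fun l => (μ l : ℕ) ≠ 0)).card = 1 ∧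
        (∑ i, (μ i : ℕ)) = (e + 1) * (p - c + 1) - j ↔ (Finset.univ.filter (fun l => (μ l : ℕ) ≠ 0)).card = 1 ∧
        j + ∑ i, (μ i : ℕ) = (e + 1) * (p - c + 1) by omega)] at h
    rw [h, Nat.mul_succ]
    by_cases h1 : (e + 1) * (p - c) < j ∧ j < (e + 1) * (p - c) + (e + 1)
    · rw [if_pos h1, if_pos (by omega)]
    · rw [if_neg h1, if_neg (by omega)]
  · rw [if_neg (by omega), Finset.card_eq_zero.mpr]
    exact Finset.filter_eq_empty_iff.mpr (fun μ _ h => absurd h.2 (by omega))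

/-- (C3) the whole correction sum for `c < p`, `k + c = 2p + 1`:
`Σ_μ = [j = (e+1)(p − c) ∨ j = (e+1)(p − c + 1)] + k · [(e+1)(p − c) < j < (e+1)(p − c + 1)]` ((S0) + (C2); labels with `s ≥ 2` vanish by (S2)). -/
theorem sum_single_eq (p k e c j : ℕ) (hcp : c < p) (hk : k + c = 2 * p + 1) :
    (∑ μ : Fin k → Fin (e + 1),
      (if (e + 1) ∣ (j + ∑ i, (μ i : ℕ)) ∧ (e + 1) * (Finset.univ.filter (fun l => (μ l : ℕ) ≠ 0)).card ≤ j + ∑ i, (μ i : ℕ) then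
        (if k - (Finset.univ.filter (fun l => (μ l : ℕ) ≠ 0)).card < ((j + ∑ i, (μ i : ℕ)) / (e + 1) - (Finset.univ.filter (fun l => (μ l : ℕ) ≠ 0)).card) + c then 0
         else if min ((j + ∑ i, (μ i : ℕ)) / (e + 1) - (Finset.univ.filter (fun l => (μ l : ℕ) ≠ 0)).card)
             (k - (Finset.univ.filter (fun l => (μ l : ℕ) ≠ 0)).card -
               ((j + ∑ i, (μ i : ℕ)) / (e + 1) - (Finset.univ.filter (fun l => (μ l : ℕ) ≠ 0)).card) - c) + c < p then 0
         else (k - (Finset.univ.filter (fun l => (μ l : ℕ) ≠ 0)).card).choose (min ((j + ∑ i, (μ i : ℕ)) / (e + 1) - (Finset.univ.filter (fun l => (μ l : ℕ) ≠ 0)).card)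
             (k - (Finset.univ.filter (fun l => (μ l : ℕ) ≠ 0)).card -
               ((j + ∑ i, (μ i : ℕ)) / (e + 1) - (Finset.univ.filter (fun l => (μ l : ℕ) ≠ 0)).card) - c) + c - p))
       else 0)) =
    (if j = (e + 1) * (p - c) ∨ j = (e + 1) * (p - c + 1) then 1 else 0) +
      (if (e + 1) * (p - c) < j ∧ j < (e + 1) * (p - c + 1) then k else 0) := by
  rw [← Finset.sum_filter_add_sum_filter_not Finset.univ
      (fun μ : Fin k → Fin (e + 1) => (Finset.univ.filter (fun l => (μ l : ℕ) ≠ 0)).card = 1),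
    sum_filter_card_eq_one_single p k e c j hcp hk, add_comm]
  congr 1
  rw [Finset.sum_eq_single_of_mem (fun _ => (0 : Fin (e + 1)))
      (Finset.mem_filter.mpr ⟨Finset.mem_univ _, by simp⟩) (fun μ hμ hne => ?_)]
  · have h0 := single_zero_label p k e c j hcp hk
    simp only [] at h0
    rw [h0]
  · obtain ⟨l, hl⟩ := Function.ne_iff.mp hne
    have hs1 : 1 ≤ (Finset.univ.filter (fun l => (μ l : ℕ) ≠ 0)).card :=
      Finset.card_pos.mpr ⟨l, Finset.mem_filter.mpr ⟨Finset.mem_univ _, fun h => hl (Fin.ext h)⟩⟩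
    exact single_eq_zero_of_two_le p k e c j hk.le μ (by have := (Finset.mem_filter.mp hμ).2; omega)

/-- **(BDRY2) THE SECOND BOUNDARY `k + c = 2p + 1` DROPS `1, k, …, k, 1` ACROSS ONE BAND.** For a prime `p`, `1 ≤ c < p` and `k = 2p + 1 − c`
variables, anchor 229's multiplicity matrix of `×q^c` on `K[x₁,…,x_k]/(xᵢ^{e+2})` at level `j` (VERBATIM) has characteristic-`p` rank
`rank_{K₀} − 1` at the two levels `j = (e+1)(p − c)` and `j = (e+1)(p − c + 1)`, `rank_{K₀} − k` at the `e` levels strictly between them, and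
`rank_{K₀}` at every other level ((BAND) with `k < 2p + c`, and (C3)). Anchor 304's (BDRY) is the first boundary `k + c = 2p`. -/
theorem rank_charP_add_eq_rank_charZero_second_boundary (K K₀ : Type*) [Field K] [Field K₀] (p : ℕ) [CharP K p] [CharZero K₀] (hp : p.Prime)
    (k e c j : ℕ) (hc : 0 < c) (hcp : c < p) (hk : k + c = 2 * p + 1) :
    (Matrix.of fun (v : {v : Fin k → Fin (e + 2) // (∑ i, (v i : ℕ)) + j = k * (e + 1)})
        (m : {m : Fin k → Fin (e + 2) // (∑ i, (m i : ℕ)) + (j + c * (e + 1)) = k * (e + 1)}) =>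
      ((((List.flatMap (colR (e + 3)))^[c] [List.ofFn (fun i => (m.1 i : ℕ))]).count (List.ofFn (fun i => (v.1 i : ℕ))) : ℕ) : K)).rank +
      ((if j = (e + 1) * (p - c) ∨ j = (e + 1) * (p - c + 1) then 1 else 0) +
        (if (e + 1) * (p - c) < j ∧ j < (e + 1) * (p - c + 1) then k else 0)) =
    (Matrix.of fun (v : {v : Fin k → Fin (e + 2) // (∑ i, (v i : ℕ)) + j = k * (e + 1)})
        (m : {m : Fin k → Fin (e + 2) // (∑ i, (m i : ℕ)) + (j + c * (e + 1)) = k * (e + 1)}) =>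
      ((((List.flatMap (colR (e + 3)))^[c] [List.ofFn (fun i => (m.1 i : ℕ))]).count (List.ofFn (fun i => (v.1 i : ℕ))) : ℕ) : K₀)).rank := by
  rw [← sum_single_eq p k e c j hcp hk]
  exact rank_charP_add_sum_single_eq_rank_charZero K K₀ p hp k e c j hcp (by omega)

end Summit.HodgeConjecture.HodgeConjecture.HodgeLocus.Census.UnitColumnRankDropBand
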